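import Literature.AlgebraicGeometry.HodgeTheory.PencilCircleHomotopy
import HarnessLib

/-!
# The uniform Picard–Lefschetz fact for nodal forms WITHOUT Wall's sign rule: the flat package, and the flat
# package with the exchange rule only

Family `hodge`, layer `Literature/AlgebraicGeometry/HodgeTheory`; sequel of `PicardLefschetzNodalForms` (typing seat
`littype-FH1-2`) and `PencilCircleHomotopy` §6. Written by the prover seat `hodge-nonav-19716-p2` (g10, cell `hodge-nonav`)
for crux K1-B `VeryGeneralSignCommutatorsInHg` of the route `HodgeConjecture/SignSymmetricPowers`
(stmt-HodgeConjecture-19716), programme «W-ELIM» brick 4 (memo SCOPING-WELIM-19716p2-g9 §3): the registry binder hPL =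
`picardLefschetz_nodalForms_uniform` of K1-B carries, besides the Picard–Lefschetz data with a FLAT coefficient, the
equivariant clause `IsEquivariantPicardLefschetzData` = (W) Wall's sign rule at a node FIXED by a diagonal symmetry
(AGZV II §5.1 Thm. 5.1) ∧ (O) the exchange rule at two nodes SWAPPED by it (transport of Milnor balls; Voisin II
Def. 2.12 "vanishing cycles are defined up to sign").  The algebra of the route no longer needs (W)
(`SignSymmetricTransvectionMonodromyOneSeed.eq_or_eq_neg_of_oneParamTransvection_comm`: a transvection commuting with the
involution has its centre in an eigenspace; `SignSymmetricOrbitDataUnsigned`, `SignSymmetricOneSeedHodgeGroup`).  This file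
names the two weaker packages the re-threaded route consumes, in the graded series already present in
`PicardLefschetzNodalForms` (`picardLefschetz_nodalForms` ⟸ `…_equivariant` ⟸ `…_uniform`):

* `picardLefschetz_nodalForms_flat` — the uniform statement with NO equivariance clause: one flat nowhere-zero
  coefficient `c` (`IsFlatCoefficient`), and for every nodal pencil `f₁ + c'g` the nonsingularity radius (i) and, on every
  small circle, Picard–Lefschetz data `IsPicardLefschetzData … δ (c s')` (Voisin II Thm. 3.16 with Cor. 2.17, Cor. 3.17,
  Rem. 3.21; flatness Voisin II §3.1.2/§3.2.3, Deligne Weil I (5.3)).  This is the SYMMETRY-FREE printed theorem; it is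
  what a non-equivariant localisation of the pencil monodromy at the nodes discharges.
* `IsExchangePicardLefschetzData` — clause (O) alone: for a finite-order diagonal `a` stabilising `f₁` and `g` and an
  automorphism `σ'` of the fibre acting as `[z] ↦ [a • z]`, at EXCHANGED nodes (`[a • pᵢ] = [pⱼ]`, `i ≠ j`)
  `σ'^* δⱼ = ±δᵢ`.
* `picardLefschetz_nodalForms_flatExchange` — the flat package whose data satisfy (O) (no (W)).

This file holds the three DEFINITIONS only; the implications `_uniform ⟹ _flatExchange ⟹ _flat ⟹
picardLefschetz_nodalForms`, `IsEquivariantPicardLefschetzData ⟹ IsExchangePicardLefschetzData` and the consumer shape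
«Picard–Lefschetz data at any radius» for the flat package are the theorem file `PicardLefschetzNodalFormsFlatShapes`.

Nothing here is proved about the geometry (the three packages are named facts, `Prop`-valued definitions); nothing here
says HC is proved.

## References

* [VoisinHodgeII2003] C. Voisin, Hodge Theory and Complex Algebraic Geometry II, CUP 2003: §2.2.1 Def. 2.12, Cor. 2.17,
  §2.3.1, §3.1.2, §3.2.1 Thm. 3.16, Cor. 3.17, Rem. 3.18, Rem. 3.21, §3.2.2, §3.2.3.
* [ArnoldGuseinzadeVarchenko2012] V. I. Arnold, S. M. Gusein-Zade, A. N. Varchenko, Singularities of Differentiable Maps,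
  Vol. 2: Part I §1.3 (Picard–Lefschetz theorem), §2.1 Thm. 2.1, p. 67 Corollary, §5.1 Thm. 5.1.
* [Deligne1974] P. Deligne, La conjecture de Weil. I, (5.2.1), (5.3).
* [Lamotke1981] K. Lamotke, The topology of complex projective varieties after S. Lefschetz, §6.
* [Hatcher2002] A. Hatcher, Algebraic Topology, §1.1 Lemma 1.19.
-/

noncomputable section

open CategoryTheory AlgebraicGeometry MvPolynomial
open Literature.AlgebraicTopology.SingularHomology
open Literature.AlgebraicGeometry.Motives Literature.AlgebraicGeometry.Motives.UniversalHypersurface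

namespace Literature.AlgebraicGeometry.HodgeTheory

section HodgeTheory

variable {n d : ℕ}

/-! ### §1 The exchange rule alone -/

/-- **The exchange rule** for Picard–Lefschetz data `δ` at `s'`, for the nodes `pᵢ` of the pencil `f₁ + c g` — the
SECOND clause of `IsEquivariantPicardLefschetzData`, without Wall's sign rule at fixed nodes: for every diagonal
`a ∈ (ℂˣ)ⁿ⁺²` of finite order stabilising `f₁` and `g` and every automorphism `σ'` of the fibre `Y_{s'}` over `ℂ` acting
as `[z] ↦ [a • z]` on homogeneous coordinates, at EXCHANGED nodes (`[a • pᵢ] = [pⱼ]`, `i ≠ j`) `σ'^* δⱼ = ±δᵢ` (the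
symmetry carries a Milnor ball at `pᵢ` to one at `pⱼ`, and vanishing cycles are defined up to sign).
[cite: VoisinHodgeII2003, §2.2.1 Def. 2.12 (vanishing cycles are defined up to sign) and §3.2.1 Thm. 3.16]
[cite: ArnoldGuseinzadeVarchenko2012, Part I §2.1 Thm. 2.1 and p. 67 Corollary] -/
def IsExchangePicardLefschetzData (n d k : ℕ) (f₁ g : MvPolynomial (Fin (n + 2)) ℂ)
    (p : Fin k → Fin (n + 2) → ℂ) {s' : ComplexPoints (base ℂ n d)}
    (δ : Fin k → bettiCohomology (fiberOver (family ℂ n d) s') n) : Prop :=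
  ∀ (a : Fin (n + 2) → ℂˣ), IsOfFinOrder a → a ∈ diagonalStabilizer f₁ → a ∈ diagonalStabilizer g →
    ∀ (σ' : fiberOver (family ℂ n d) s' ⟶ fiberOver (family ℂ n d) s'),
      (∀ x : ComplexPoints (fiberOver (family ℂ n d) s'),
          fibrePoint n d s' (AlgPoints.map σ' x) =
            Projectivization.mk ℂ (a • (fibrePoint n d s' x).rep)
              ((smul_ne_zero_iff_ne a).mpr (Projectivization.rep_nonzero _))) →
      ∀ i j : Fin k, i ≠ j → (∃ t : ℂ, a • p i = t • p j) →
        BettiUniverse.pull σ' n (δ j) = δ i ∨ BettiUniverse.pull σ' n (δ j) = -δ i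

/-! ### §2 The two packages -/

/-- **Picard–Lefschetz formula for nodal members of the universal family, uniform form WITHOUT any equivariance
clause** (named fact; the symmetry-free part of `picardLefschetz_nodalForms_uniform`): for `n, d ≥ 1` and every
cohomological local trivialisation datum `hU` of `π : 𝒴_U → U`, there is a FLAT nowhere-zero coefficient
`c : U(ℂ) → ℚ` (`IsFlatCoefficient`) such that for every form `f₁` of degree `d` with exactly the ordinary double
points `[p₁], …, [p_k]`, every `g` of degree `d` missing them, and some `ε₀ > 0`: (i) `f₁ + c' g` is nonsingular for
`0 < |c'| < ε₀`, and for every `0 < ε < ε₀`, every `s'` with form `f₁ + ε g` and every circle `γ` of the pencil at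
`s'`, there are vanishing cycles `δ₁, …, δ_k ∈ Hⁿ(Y_{s'}(ℂ); ℚ)` forming Picard–Lefschetz data for `γ` with the
coefficient `c(s')` (`IsPicardLefschetzData … δ (c s')`: pairwise orthogonal; monodromy `x ↦ x + c(s') Σᵢ B(x, δᵢ) δᵢ` in
degree `n`, trivial in the other degrees; `c B(δᵢ, δᵢ) = -2`, `δᵢ ≠ 0` for even `n`, `B(δᵢ, δᵢ) = 0` for odd `n`).
Implied by `picardLefschetz_nodalForms_uniform` (`…_flat_of_uniform`); implies `picardLefschetz_nodalForms`.
[cite: VoisinHodgeII2003, §3.2.1 Thm. 3.16, Cor. 3.17, Rem. 3.18, Rem. 3.21, §2.2.2 Cor. 2.17 and §3.1.2 (held text chunks p0094–p0099)]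
[cite: ArnoldGuseinzadeVarchenko2012, Part I §1.3 (Picard–Lefschetz theorem), §2.1 Thm. 2.1, p. 67 Corollary]
[cite: Deligne1974, (5.2.1) and (5.3)] [cite: Lamotke1981, §6 (the Picard–Lefschetz formulas)] -/
def picardLefschetz_nodalForms_flat : Prop :=
  ∀ (n d : ℕ) (hn : 1 ≤ n) (hd : 1 ≤ d)
    (hU : IsCohomologicallyLocallyTrivialOn (family ℂ n d) Set.univ),
    ∃ c : ComplexPoints (base ℂ n d) → ℚ, IsFlatCoefficient n d hn hd hU c ∧
      ∀ (k : ℕ) (f₁ g : MvPolynomial (Fin (n + 2)) ℂ), f₁.IsHomogeneous d → g.IsHomogeneous d →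
        ∀ (p : Fin k → Fin (n + 2) → ℂ), IsNodalFormWithNodes f₁ p → (∀ i, eval (p i) g ≠ 0) →
          ∃ ε₀ : ℝ, 0 < ε₀ ∧
            (∀ c' : ℂ, c' ≠ 0 → ‖c'‖ < ε₀ → SmoothHypersurface.IsNonsingularForm ℂ (f₁ + c' • g)) ∧
            ∀ (ε : ℝ), 0 < ε → ε < ε₀ →
              ∀ (s' : ComplexPoints (base ℂ n d)), pointForm ℂ n d s' = f₁ + (ε : ℂ) • g →
                ∀ (γ : Path s' s'), IsPencilCircle n d f₁ g ε γ →
                  ∃ δ : Fin k → bettiCohomology (fiberOver (family ℂ n d) s') n,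
                    IsPicardLefschetzData n d k hn hd hU γ δ (c s')

/-- **Picard–Lefschetz formula for nodal members of the universal family, uniform form with the EXCHANGE rule at
swapped nodes (and no sign rule at fixed nodes)** (named fact; `picardLefschetz_nodalForms_uniform` with
`IsEquivariantPicardLefschetzData` replaced by its second clause `IsExchangePicardLefschetzData`): the data of
`picardLefschetz_nodalForms_flat` can be chosen so that, for every finite-order diagonal `a` stabilising `f₁` and `g` and
every automorphism `σ'` of `Y_{s'}` acting as `[z] ↦ [a • z]`, `σ'^* δⱼ = ±δᵢ` whenever `[a • pᵢ] = [pⱼ]`, `i ≠ j`.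
Implied by `picardLefschetz_nodalForms_uniform`; implies `picardLefschetz_nodalForms_flat`.
[cite: VoisinHodgeII2003, §3.2.1 Thm. 3.16, Cor. 3.17, Rem. 3.21, §3.1.2 and §2.2.1 Def. 2.12]
[cite: ArnoldGuseinzadeVarchenko2012, Part I §1.3, §2.1 Thm. 2.1 and p. 67 Corollary]
[cite: Deligne1974, (5.2.1) and (5.3)] -/
def picardLefschetz_nodalForms_flatExchange : Prop :=
  ∀ (n d : ℕ) (hn : 1 ≤ n) (hd : 1 ≤ d)
    (hU : IsCohomologicallyLocallyTrivialOn (family ℂ n d) Set.univ),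
    ∃ c : ComplexPoints (base ℂ n d) → ℚ, IsFlatCoefficient n d hn hd hU c ∧
      ∀ (k : ℕ) (f₁ g : MvPolynomial (Fin (n + 2)) ℂ), f₁.IsHomogeneous d → g.IsHomogeneous d →
        ∀ (p : Fin k → Fin (n + 2) → ℂ), IsNodalFormWithNodes f₁ p → (∀ i, eval (p i) g ≠ 0) →
          ∃ ε₀ : ℝ, 0 < ε₀ ∧
            (∀ c' : ℂ, c' ≠ 0 → ‖c'‖ < ε₀ → SmoothHypersurface.IsNonsingularForm ℂ (f₁ + c' • g)) ∧
            ∀ (ε : ℝ), 0 < ε → ε < ε₀ →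
              ∀ (s' : ComplexPoints (base ℂ n d)), pointForm ℂ n d s' = f₁ + (ε : ℂ) • g →
                ∀ (γ : Path s' s'), IsPencilCircle n d f₁ g ε γ →
                  ∃ δ : Fin k → bettiCohomology (fiberOver (family ℂ n d) s') n,
                    IsPicardLefschetzData n d k hn hd hU γ δ (c s') ∧
                      IsExchangePicardLefschetzData n d k f₁ g p δ

end HodgeTheory

end Literature.AlgebraicGeometry.HodgeTheory

end
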